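import Summits.NavierStokesRegularity.NavierStokesRegularity.Theorems.TypeILiouvilleTypeIliouvilleNoTypeIIASlabModL
import Mathlib.Analysis.SpecialFunctions.Pow.Integral
import Mathlib.Analysis.SpecialFunctions.ImproperIntegrals
import HarnessLib

/-!
# REACH C2: a weak-`L³` bound near the blow-up gives the `A`-slab clause — hence, modulo (L), the
# Type-I rate (crux `TypeIliouvilleNoTypeII`, stmt-NavierStokesRegularity-0056; §B keep/kill calibration)

Helper file (theorems only).  In the §B critics' REACH lattice (KILLKIT §C) the node **C2** is the
critical weak norm: `sup_{t < T} ‖u(t)‖_{L^{3,∞}} ≤ M` near a first blow-up time `T`; the gap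
«C2 ⇒ C3» (weak-`L³` boundedness ⇒ the pointwise Type-I rate of the hard core `NoTypeII`) is recorded
there as an OPEN Type-I upgrade, not found in print.  ns-typeII-p2's `…ASlabModL.lean` closed the
chain `ASlab ∧ (L) ⇒ NoTypeII` in the kernel, where **ASlab** asks only for a bound on
Albritton–Barker's scaled local kinetic energy
`A(ũ; Q_r(z)) = ess sup_{t ∈ (t₀ - r², t₀)} r⁻¹ ∫_{B_r(x₀)} |ũ(t)|²` over the parabolic balls of a
final slab of the viscosity-normalised field `ũ(s, x) = ν⁻¹ u(s/ν, x)`, and observed in prose that C2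
sits above ASlab.  This file makes that observation a kernel theorem and composes:

* `lintegral_enorm_sq_le_of_tail` — the LORENTZ–HÖLDER step as a layer-cake estimate: for any measure
  `μ` and threshold `λ₀ > 0`, a tail bound `μ{‖f‖ > t} ≤ (M/t)³` for `t > λ₀` gives
  `∫ ‖f‖² dμ ≤ 2 (μ(univ) λ₀² + M³/λ₀)`;
* `lintegral_ball_enorm_sq_le_of_weakL3` — on a ball of `ℝ³`, with `λ₀ = M/r`:
  `∫_{B_r(x₀)} ‖f‖² ≤ 2 (|B₁| + 1) M² r` whenever `vol{‖f‖ > t} ≤ (M/t)³` for all `t > 0`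
  (weak-`L³` in distribution form — the tree has no Lorentz space, so `L^{3,∞}` is spelled out);
* `cknAEss_le_of_weakL3` — hence `A(w; Q_r(z)) ≤ 2 (|B₁| + 1) M²` for EVERY parabolic ball whose
  times carry the weak-`L³` bound `M` (a constant independent of `r` and `z`: C2 ⇒ ASlab);
* `weakL3_timeRescale` — the bound passes to `ũ = timeRescale ν⁻¹ ν⁻¹ u` with constant `M/ν`;
* `isTypeIBlowup_of_weakL3_of_liouvilleL` — per solution: under KNSS's Liouville conjecture (L)
  (`TypeIliouvilleL`, the route's own hard core stmt-NavierStokesRegularity-10661), a maximal smooth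
  solution, Leray–Hopf from a rapidly decaying datum, with `‖u(t)‖_{L^{3,∞}} ≤ M` on a final time
  interval blows up at the Type-I rate (`TypeIIZoom.isTypeIBlowup_of_cknAEssSlab_of_liouvilleL`);
* `typeIliouvilleNoTypeII_of_weakL3_of_liouvilleL` — **`NoTypeII ⇐ (a-priori C2) ∧ (L)`** BY NAME;
* `navierStokesRegularity_of_weakL3_of_liouvilleL` — **`Clay (A) ⇐ (a-priori C2) ∧ (L)`** through the
  deciding theorem of route `TypeILiouville` (p2's `navierStokesRegularity_of_cknAEssSlab_of_liouvilleL`).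

READING for the critics: the token `RETYPE:REACH-GAP:C2` now reads «gap = (L) exactly; kit side
closed»: a §B candidate whose natural output is a weak-`L³` (C2) bound reaches C3 = 0056 modulo the
Liouville hard core (L) and nothing else.  Weak-`L³` does NOT control `C = r⁻²∫∫|u|³` (logarithmic
divergence of `|x|⁻¹ ∈ L^{3,∞}`) nor `E`; only the `A`-clause is reached, which is why p2's `A`-only
chain is the one used.  WHAT THIS IS NOT: not NS regularity and not the `L^{3,∞}` regularity problem —
(L) and every a-priori C2 bound are OPEN; these are implications between open statements. [folklore]

References: Albritton–Barker 2019 §1 (the lattice `(c_p)`, `𝐈 < ∞`; arXiv:1811.00502 p. 4);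
Koch–Nadirashvili–Seregin–Šverák 2009 §1 (L), §6; Grafakos, *Classical Fourier Analysis*, Prop. 1.4.9
and Ex. 1.1.11 (Hölder's inequality for weak `L^p` on sets of finite measure).
-/

noncomputable section

-- the summit and its single problem share the name `NavierStokesRegularity` (D-0017 nested layout)
set_option linter.dupNamespace false

open Set Function Filter Topology MeasureTheory Metric
open scoped NNReal ENNReal

namespace Summit.NavierStokesRegularity.NavierStokesRegularity.Theorems.TypeIliouvilleNoTypeII.WeakL3Reach

open Literature.Analysis Literature.Analysis.FluidPDE
open Summit.NavierStokesRegularity.NavierStokesRegularity.Theorems.TypeIliouvilleNoTypeII.TypeIIZoom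
open Summit.NavierStokesRegularity.NavierStokesRegularity.Theses.TypeILiouville (TypeIliouvilleL
  TypeIliouvilleNoTypeII)

/-! ## The Lorentz–Hölder step by layer cake -/

section LayerCake

variable {X : Type*} [MeasurableSpace X] {F : Type*} [NormedAddCommGroup F]

/-- **Layer-cake bound from a cubic tail.**  For any measure `μ`, any `f` with a.e.-strongly
measurable values in a normed group, and a threshold `λ₀ > 0`: if `μ{x : t < ‖f x‖} ≤ (M/t)³` for all
`t > λ₀` (`M ≥ 0`), then `∫ ‖f‖² dμ ≤ 2 (μ(univ) · λ₀² + M³/λ₀)` — split the layer-cake integral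
`∫ ‖f‖² = 2 ∫₀^∞ t · μ{‖f‖ > t} dt` at `λ₀`, bounding the measure by `μ(univ)` below the threshold and
by the tail above it (`∫_{λ₀}^∞ M³ t⁻² dt = M³/λ₀`). [cite: Grafakos2014, Prop. 1.4.9 and Ex. 1.1.11] -/
theorem lintegral_enorm_sq_le_of_tail (μ : Measure X) {f : X → F} (hf : AEStronglyMeasurable f μ)
    {M lam0 : ℝ} (hM : 0 ≤ M) (hlam0 : 0 < lam0)
    (htail : ∀ t : ℝ, lam0 < t → μ {x | t < ‖f x‖} ≤ ENNReal.ofReal ((M / t) ^ 3)) :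
    ∫⁻ x, ‖f x‖ₑ ^ 2 ∂μ ≤
      ENNReal.ofReal 2 * (μ univ * ENNReal.ofReal (lam0 ^ 2) + ENNReal.ofReal (M ^ 3 / lam0)) := by
  -- rewrite the integrand as `ofReal (‖f x‖ ^ 2)` and apply the layer-cake formula with `p = 2`
  have hint : ∫⁻ x, ‖f x‖ₑ ^ 2 ∂μ = ∫⁻ x, ENNReal.ofReal (‖f x‖ ^ (2 : ℝ)) ∂μ := by
    refine lintegral_congr fun x => ?_
    rw [Real.rpow_two, ENNReal.ofReal_pow (norm_nonneg _), ofReal_norm]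
  have hnn : 0 ≤ᵐ[μ] fun x => ‖f x‖ := Eventually.of_forall fun x => norm_nonneg _
  have hmeas : AEMeasurable (fun x => ‖f x‖) μ := hf.norm.aemeasurable
  rw [hint, lintegral_rpow_eq_lintegral_meas_lt_mul μ hnn hmeas (by norm_num : (0 : ℝ) < 2)]
  gcongr
  -- the integrand of the tail formula
  set g : ℝ → ℝ≥0∞ := fun t => μ {x | t < ‖f x‖} * ENNReal.ofReal (t ^ ((2 : ℝ) - 1)) with hg
  have hg1 : ∀ t : ℝ, 0 < t → g t = μ {x | t < ‖f x‖} * ENNReal.ofReal t := by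
    intro t ht
    rw [hg]
    simp only
    rw [show (2 : ℝ) - 1 = 1 by norm_num, Real.rpow_one]
  -- split `(0, ∞) = (0, λ₀] ∪ (λ₀, ∞)`
  have hsplit : Ioi (0 : ℝ) = Ioc 0 lam0 ∪ Ioi lam0 := (Ioc_union_Ioi_eq_Ioi hlam0.le).symm
  rw [hsplit, lintegral_union measurableSet_Ioi Ioc_disjoint_Ioi_same]
  gcongr
  · -- below the threshold: `μ{‖f‖ > t} · t ≤ μ(univ) · λ₀`, over an interval of length `λ₀`
    calc ∫⁻ t in Ioc 0 lam0, g t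
        ≤ ∫⁻ _ in Ioc 0 lam0, μ univ * ENNReal.ofReal lam0 := by
          refine setLIntegral_mono measurable_const fun t ht => ?_
          rw [hg1 t ht.1]
          exact mul_le_mul' (measure_mono (subset_univ _)) (ENNReal.ofReal_le_ofReal ht.2)
      _ = μ univ * ENNReal.ofReal (lam0 ^ 2) := by
          rw [setLIntegral_const, Real.volume_Ioc, sub_zero, mul_assoc, ← ENNReal.ofReal_mul hlam0.le,
            pow_two]
  · -- above the threshold: `μ{‖f‖ > t} · t ≤ M³ t⁻²`, and `∫_{λ₀}^∞ M³ t⁻² dt = M³/λ₀`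
    have hle : ∀ t ∈ Ioi lam0, g t ≤ ENNReal.ofReal (M ^ 3 * t ^ (-2 : ℝ)) := by
      intro t ht
      have ht0 : 0 < t := hlam0.trans ht
      rw [hg1 t ht0]
      calc μ {x | t < ‖f x‖} * ENNReal.ofReal t
          ≤ ENNReal.ofReal ((M / t) ^ 3) * ENNReal.ofReal t := mul_le_mul' (htail t ht) le_rfl
        _ = ENNReal.ofReal ((M / t) ^ 3 * t) := (ENNReal.ofReal_mul (by positivity)).symm
        _ = ENNReal.ofReal (M ^ 3 * t ^ (-2 : ℝ)) := by
            congr 1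
            rw [div_pow, Real.rpow_neg ht0.le, show (2 : ℝ) = ((2 : ℕ) : ℝ) by norm_num,
              Real.rpow_natCast]
            field_simp
    have hint2 : IntegrableOn (fun t : ℝ => M ^ 3 * t ^ (-2 : ℝ)) (Ioi lam0) volume :=
      (integrableOn_Ioi_rpow_of_lt (by norm_num) hlam0).const_mul _
    calc ∫⁻ t in Ioi lam0, g t
        ≤ ∫⁻ t in Ioi lam0, ENNReal.ofReal (M ^ 3 * t ^ (-2 : ℝ)) :=
          setLIntegral_mono' measurableSet_Ioi hle
      _ = ENNReal.ofReal (∫ t in Ioi lam0, M ^ 3 * t ^ (-2 : ℝ)) := by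
          rw [ofReal_integral_eq_lintegral_ofReal hint2]
          filter_upwards [ae_restrict_mem measurableSet_Ioi] with t ht
          exact mul_nonneg (pow_nonneg hM 3) (Real.rpow_nonneg (hlam0.trans ht).le _)
      _ = ENNReal.ofReal (M ^ 3 / lam0) := by
          rw [integral_const_mul, integral_Ioi_rpow_of_lt (by norm_num) hlam0]
          congr 1
          rw [show (-2 : ℝ) + 1 = -1 by norm_num, Real.rpow_neg_one]
          field_simp

end LayerCake

/-! ## Weak-`L³` on `ℝ³`: the scaled local kinetic energy is bounded -/

/-- `|B₁|`: the volume of the unit ball of `ℝ³`, as a real number (positive and finite). -/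
theorem volume_unitBall_toReal_pos :
    0 < (volume (ball (0 : EuclideanSpace ℝ (Fin 3)) 1)).toReal :=
  ENNReal.toReal_pos (measure_ball_pos volume _ one_pos).ne' measure_ball_lt_top.ne

/-- **Hölder's inequality for weak-`L³` on a ball of `ℝ³`.**  If `vol{x : t < ‖f x‖} ≤ (M/t)³` for
every `t > 0` (`‖f‖_{L^{3,∞}} ≤ M` in distribution form, `M > 0`) and `f` is a.e.-strongly measurable,
then for every ball `∫_{B_r(x₀)} ‖f‖² ≤ 2 (|B₁| + 1) M² r` (`r > 0`): the layer-cake bound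
`lintegral_enorm_sq_le_of_tail` on `B_r(x₀)` with threshold `λ₀ = M/r`. [cite: Grafakos2014, Ex. 1.1.11] -/
theorem lintegral_ball_enorm_sq_le_of_weakL3
    {f : EuclideanSpace ℝ (Fin 3) → EuclideanSpace ℝ (Fin 3)} (hf : AEStronglyMeasurable f volume)
    {M : ℝ} (hM : 0 < M)
    (hweak : ∀ t : ℝ, 0 < t → volume {x | t < ‖f x‖} ≤ ENNReal.ofReal ((M / t) ^ 3))
    (x₀ : EuclideanSpace ℝ (Fin 3)) {r : ℝ} (hr : 0 < r) :
    ∫⁻ x in ball x₀ r, ‖f x‖ₑ ^ 2 ≤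
      ENNReal.ofReal (2 * ((volume (ball (0 : EuclideanSpace ℝ (Fin 3)) 1)).toReal + 1) * M ^ 2 * r) := by
  set b : ℝ := (volume (ball (0 : EuclideanSpace ℝ (Fin 3)) 1)).toReal with hb
  have hb0 : 0 < b := volume_unitBall_toReal_pos
  -- the tail bound for the restricted measure
  have htail : ∀ t : ℝ, M / r < t →
      (volume.restrict (ball x₀ r)) {x | t < ‖f x‖} ≤ ENNReal.ofReal ((M / t) ^ 3) := by
    intro t ht
    have ht0 : 0 < t := (div_pos hM hr).trans ht
    rw [Measure.restrict_apply' measurableSet_ball]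
    exact (measure_mono inter_subset_left).trans (hweak t ht0)
  have h1 := lintegral_enorm_sq_le_of_tail (volume.restrict (ball x₀ r)) hf.restrict hM.le
    (div_pos hM hr) htail
  refine h1.trans (le_of_eq ?_)
  -- `μ(univ) = |B_r| = r³ |B₁|`
  have hvol : (volume.restrict (ball x₀ r)) univ = ENNReal.ofReal (r ^ 3 * b) := by
    rw [Measure.restrict_apply_univ, Measure.addHaar_ball_of_pos volume x₀ hr,
      finrank_euclideanSpace_fin, hb, ENNReal.ofReal_mul (by positivity),
      ENNReal.ofReal_toReal measure_ball_lt_top.ne]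
  rw [hvol, ← ENNReal.ofReal_mul (by positivity), ← ENNReal.ofReal_add (by positivity) (by positivity),
    ← ENNReal.ofReal_mul (by norm_num)]
  congr 1
  field_simp

/-- **C2 ⇒ ASlab (the scaled local kinetic energy under a weak-`L³` bound).**  Let `w : ℝ → ℝ³ → ℝ³`
and let `Q_r(z)`, `r > 0`, be a parabolic ball whose times `t ∈ (t₀ - r², t₀)` all carry the weak-`L³`
bound `vol{x : s < ‖w(t, x)‖} ≤ (M/s)³` (`s > 0`; `M > 0`) with `w(t)` a.e.-strongly measurable.  Then
Albritton–Barker's `A(w; Q_r(z)) = ess sup_t r⁻¹ ∫_{B_r(x₀)} |w(t)|² ≤ 2 (|B₁| + 1) M²` — a constant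
INDEPENDENT of `r` and `z`. [cite: AlbrittonBarker2019, §1 p. 4 (arXiv:1811.00502)] -/
theorem cknAEss_le_of_weakL3 {w : ℝ → EuclideanSpace ℝ (Fin 3) → EuclideanSpace ℝ (Fin 3)}
    {M : ℝ} (hM : 0 < M) {r : ℝ} (hr : 0 < r) {z : ℝ × EuclideanSpace ℝ (Fin 3)}
    (hmeas : ∀ t ∈ Ioo (z.1 - r ^ 2) z.1, AEStronglyMeasurable (w t) volume)
    (hweak : ∀ t ∈ Ioo (z.1 - r ^ 2) z.1, ∀ s : ℝ, 0 < s →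
      volume {x | s < ‖w t x‖} ≤ ENNReal.ofReal ((M / s) ^ 3)) :
    cknAEss r z w ≤
      ENNReal.ofReal (2 * ((volume (ball (0 : EuclideanSpace ℝ (Fin 3)) 1)).toReal + 1) * M ^ 2) := by
  unfold cknAEss
  refine essSup_le_of_ae_le _ ?_
  filter_upwards [ae_restrict_mem measurableSet_Ioo] with t ht
  have h1 := lintegral_ball_enorm_sq_le_of_weakL3 (hmeas t ht) hM (hweak t ht) z.2 hr
  calc (ENNReal.ofReal r)⁻¹ * ∫⁻ x in ball z.2 r, ‖w t x‖ₑ ^ 2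
      ≤ (ENNReal.ofReal r)⁻¹ * ENNReal.ofReal
          (2 * ((volume (ball (0 : EuclideanSpace ℝ (Fin 3)) 1)).toReal + 1) * M ^ 2 * r) := by
        gcongr
    _ = ENNReal.ofReal (2 * ((volume (ball (0 : EuclideanSpace ℝ (Fin 3)) 1)).toReal + 1) * M ^ 2) := by
        have hb0 := volume_unitBall_toReal_pos
        rw [show 2 * ((volume (ball (0 : EuclideanSpace ℝ (Fin 3)) 1)).toReal + 1) * M ^ 2 * r =
            r * (2 * ((volume (ball (0 : EuclideanSpace ℝ (Fin 3)) 1)).toReal + 1) * M ^ 2) by ring,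
          ENNReal.ofReal_mul hr.le, ← mul_assoc, ENNReal.inv_mul_cancel
            ((ENNReal.ofReal_pos.2 hr).ne') ENNReal.ofReal_ne_top, one_mul]

/-! ## The viscosity normalisation -/

/-- **Weak-`L³` bounds under the viscosity normalisation.**  If `vol{x : s < ‖u(t, x)‖} ≤ (M/s)³` for
all `s > 0`, then the normalised field `ũ = timeRescale ν⁻¹ ν⁻¹ u`, `ũ(τ, x) = ν⁻¹ u(τ/ν, x)`, obeys
`vol{x : s < ‖ũ(τ, x)‖} ≤ ((M/ν)/s)³` at `τ = ν t` — the level sets are the same sets at level `ν s`.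
[cite: Tao2011, footnote 3] -/
theorem weakL3_timeRescale {ν M : ℝ} (hν : 0 < ν)
    {u : ℝ → EuclideanSpace ℝ (Fin 3) → EuclideanSpace ℝ (Fin 3)} {τ : ℝ}
    (hweak : ∀ s : ℝ, 0 < s → volume {x | s < ‖u (ν⁻¹ * τ) x‖} ≤ ENNReal.ofReal ((M / s) ^ 3))
    {s : ℝ} (hs : 0 < s) :
    volume {x | s < ‖timeRescale ν⁻¹ ν⁻¹ u τ x‖} ≤ ENNReal.ofReal ((M / ν / s) ^ 3) := by
  have hset : {x | s < ‖timeRescale ν⁻¹ ν⁻¹ u τ x‖} = {x | ν * s < ‖u (ν⁻¹ * τ) x‖} := by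
    ext x
    simp only [mem_setOf_eq, timeRescale_apply, norm_smul, norm_inv, Real.norm_of_nonneg hν.le]
    rw [← div_eq_inv_mul, lt_div_iff₀ hν, mul_comm]
  rw [hset]
  refine (hweak (ν * s) (mul_pos hν hs)).trans (le_of_eq ?_)
  congr 2
  field_simp

/-! ## REACH C2 modulo (L) -/

variable {ν T : ℝ} {u : ℝ → EuclideanSpace ℝ (Fin 3) → EuclideanSpace ℝ (Fin 3)}
  {p : ℝ → EuclideanSpace ℝ (Fin 3) → ℝ}

/-- **The `A`-slab clause from a weak-`L³` bound near the blow-up.**  Let `(u, p)` be a classical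
solution on `ℝ³ × [0, T)` with `vol{x : s < ‖u(t, x)‖} ≤ (M/s)³` for all `s > 0` and all
`t ∈ (t₁, T)`, `0 ≤ t₁ < T`, `M > 0`.  Then on the final slab `(ν t₁, ν T) × ℝ³` of the normalised field
`ũ = timeRescale ν⁻¹ ν⁻¹ u` EVERY parabolic ball has `A(ũ; Q) ≤ 2 (|B₁| + 1) (M/ν)²` — the hypothesis `hA`
of `TypeIIZoom.isTypeIBlowup_of_cknAEssSlab_of_liouvilleL`. [cite: AlbrittonBarker2019, §1 p. 4 (arXiv:1811.00502)] -/
theorem cknAEssSlab_of_weakL3 (hν : 0 < ν) (hsol : IsClassicalNSSolutionOn (Ico 0 T) ν 0 u p)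
    {M t₁ : ℝ} (hM : 0 < M) (ht₁ : 0 ≤ t₁)
    (hweak : ∀ t ∈ Ioo t₁ T, ∀ s : ℝ, 0 < s → volume {x | s < ‖u t x‖} ≤ ENNReal.ofReal ((M / s) ^ 3)) :
    ∀ r : ℝ, 0 < r → ∀ z : ℝ × EuclideanSpace ℝ (Fin 3),
      parabolicCylinder r z ⊆ Ioo (ν * t₁) (ν * T) ×ˢ univ →
      cknAEss r z (timeRescale ν⁻¹ ν⁻¹ u) ≤
        ENNReal.ofReal (2 * ((volume (ball (0 : EuclideanSpace ℝ (Fin 3)) 1)).toReal + 1) * (M / ν) ^ 2) := by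
  intro r hr z hQ
  -- the times of the ball lie in the slab
  have htimes : Ioo (z.1 - r ^ 2) z.1 ⊆ Ioo (ν * t₁) (ν * T) := by
    have hne : (ball z.2 r).Nonempty := ⟨z.2, mem_ball_self hr⟩
    rcases (prod_subset_prod_iff.1 hQ) with h | h | h
    · exact h.1
    · exact absurd h (nonempty_Ioo.2 (by nlinarith [sq_nonneg r, hr])).ne_empty
    · exact absurd h hne.ne_empty
  -- physical time of a slab time
  have hphys : ∀ τ ∈ Ioo (z.1 - r ^ 2) z.1, ν⁻¹ * τ ∈ Ioo t₁ T := by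
    intro τ hτ
    have h := htimes hτ
    constructor
    · rw [lt_inv_mul_iff₀ hν]; exact h.1
    · rw [inv_mul_lt_iff₀ hν]; exact h.2
  refine cknAEss_le_of_weakL3 (div_pos hM hν) hr (fun τ hτ => ?_) (fun τ hτ s hs => ?_)
  · -- measurability: the physical slice is smooth
    have hτT : ν⁻¹ * τ ∈ Ico 0 T := ⟨ht₁.trans (hphys τ hτ).1.le, (hphys τ hτ).2⟩
    have hc : Continuous (u (ν⁻¹ * τ)) := (hsol.contDiff_velocity hτT).continuous
    rw [timeRescale_slice]
    exact (hc.const_smul ν⁻¹).aestronglyMeasurable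
  · exact weakL3_timeRescale hν (fun s' hs' => hweak _ (hphys τ hτ) s' hs') hs

/-- **REACH C2, per solution: under (L), a weak-`L³` bound near the blow-up forces the Type-I rate.**
Let `(u, p)` be a maximal smooth solution of Navier–Stokes on `ℝ³ × [0, T)`, Leray–Hopf from a rapidly
decaying datum, with `‖u(t)‖_{L^{3,∞}} ≤ M` on a final interval `(t₁, T)` in distribution form
(`vol{x : s < ‖u(t, x)‖} ≤ (M/s)³` for all `s > 0`).  If KNSS's Liouville conjecture (L) holds
(`TypeIliouvilleL`), the blow-up is Type I: `IsTypeIBlowup u T`.  Proof: `cknAEssSlab_of_weakL3` feeds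
ns-typeII-p2's `TypeIIZoom.isTypeIBlowup_of_cknAEssSlab_of_liouvilleL` (Type-II zoom package, transfer
of `A`, rigidity of the limit under (L)). [cite: KochNadirashviliSereginSverak2009, §1 conjecture (L) and §6 Prop. 6.1 (arXiv:0709.3599)] -/
theorem isTypeIBlowup_of_weakL3_of_liouvilleL (hL : TypeIliouvilleL) (hν : 0 < ν) (hT : 0 < T)
    (hmax : IsMaximalSmoothSolution ν 0 u p T) (hLH : IsLerayHopfOn T ν 0 (u 0) u)
    (hdec : HasRapidSpatialDecay (u 0)) {M t₁ : ℝ} (hM : 0 < M) (ht₁ : t₁ < T)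
    (hweak : ∀ t ∈ Ioo t₁ T, ∀ s : ℝ, 0 < s → volume {x | s < ‖u t x‖} ≤ ENNReal.ofReal ((M / s) ^ 3)) :
    IsTypeIBlowup u T := by
  -- WLOG `t₁ ≥ 0`
  set t₁' : ℝ := max t₁ 0 with ht₁'
  have ht₁'0 : 0 ≤ t₁' := le_max_right _ _
  have ht₁'T : t₁' < T := max_lt ht₁ hT
  have hweak' : ∀ t ∈ Ioo t₁' T, ∀ s : ℝ, 0 < s →
      volume {x | s < ‖u t x‖} ≤ ENNReal.ofReal ((M / s) ^ 3) :=
    fun t ht => hweak t ⟨(le_max_left _ _).trans_lt ht.1, ht.2⟩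
  have hS₁ : ν * t₁' < ν * T := mul_lt_mul_of_pos_left ht₁'T hν
  exact isTypeIBlowup_of_cknAEssSlab_of_liouvilleL hL hν hT hmax hLH hdec hS₁ ENNReal.ofReal_ne_top
    (cknAEssSlab_of_weakL3 hν hmax.1 hM ht₁'0 hweak')

/-- **`NoTypeII ⇐ (a-priori C2) ∧ (L)`, BY NAME.**  If every maximal smooth solution of unforced
Navier–Stokes on `ℝ³ × [0, T)`, Leray–Hopf from a rapidly decaying datum, is bounded in weak-`L³` on a
final time interval (`∃ M > 0, t₁ < T`, `vol{s < ‖u(t)‖} ≤ (M/s)³` for `t ∈ (t₁, T)`, `s > 0`) and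
KNSS's Liouville conjecture (L) holds, then `TypeIliouvilleNoTypeII` (stmt-NavierStokesRegularity-0056).
The critics' REACH-GAP «C2 ⇒ C3» is thereby located: it is closed modulo the hard core (L) and nothing
else. [cite: KochNadirashviliSereginSverak2009, §1 conjecture (L) and §6 (arXiv:0709.3599)] -/
theorem typeIliouvilleNoTypeII_of_weakL3_of_liouvilleL
    (hC2 : ∀ (ν T : ℝ), 0 < ν → 0 < T →
      ∀ (u : ℝ → EuclideanSpace ℝ (Fin 3) → EuclideanSpace ℝ (Fin 3))
        (p : ℝ → EuclideanSpace ℝ (Fin 3) → ℝ),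
      IsMaximalSmoothSolution ν 0 u p T → IsLerayHopfOn T ν 0 (u 0) u → HasRapidSpatialDecay (u 0) →
      ∃ M t₁ : ℝ, 0 < M ∧ t₁ < T ∧
        ∀ t ∈ Ioo t₁ T, ∀ s : ℝ, 0 < s → volume {x | s < ‖u t x‖} ≤ ENNReal.ofReal ((M / s) ^ 3))
    (hL : TypeIliouvilleL) : TypeIliouvilleNoTypeII := by
  intro ν T hν hT u p hmax hLH hdec
  obtain ⟨M, t₁, hM, ht₁, hweak⟩ := hC2 ν T hν hT u p hmax hLH hdec
  exact isTypeIBlowup_of_weakL3_of_liouvilleL hL hν hT hmax hLH hdec hM ht₁ hweak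

/-- **`Clay (A) ⇐ (a-priori C2) ∧ (L)`.**  An a-priori weak-`L³` bound near the lifespan of every
maximal smooth solution from rapidly decaying Leray–Hopf data, together with KNSS's Liouville conjecture
(L), gives the Clay Millennium statement (A) — via `cknAEssSlab_of_weakL3` and ns-typeII-p2's
`TypeIIZoom.navierStokesRegularity_of_cknAEssSlab_of_liouvilleL` (deciding theorem of route
`TypeILiouville`).  Both hypotheses are OPEN; this is a relocation certificate, not a regularity
claim. [cite: KochNadirashviliSereginSverak2009, §1 and §6 Prop. 6.1 (arXiv:0709.3599)] -/
theorem navierStokesRegularity_of_weakL3_of_liouvilleL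
    (hC2 : ∀ (ν T : ℝ), 0 < ν → 0 < T →
      ∀ (u : ℝ → EuclideanSpace ℝ (Fin 3) → EuclideanSpace ℝ (Fin 3))
        (p : ℝ → EuclideanSpace ℝ (Fin 3) → ℝ),
      IsMaximalSmoothSolution ν 0 u p T → IsLerayHopfOn T ν 0 (u 0) u → HasRapidSpatialDecay (u 0) →
      ∃ M t₁ : ℝ, 0 < M ∧ t₁ < T ∧
        ∀ t ∈ Ioo t₁ T, ∀ s : ℝ, 0 < s → volume {x | s < ‖u t x‖} ≤ ENNReal.ofReal ((M / s) ^ 3))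
    (hL : TypeIliouvilleL) : _root_.NavierStokesRegularity := by
  refine navierStokesRegularity_of_cknAEssSlab_of_liouvilleL (fun ν T hν hT u p hmax hLH hdec => ?_) hL
  obtain ⟨M, t₁, hM, ht₁, hweak⟩ := hC2 ν T hν hT u p hmax hLH hdec
  refine ⟨ν * max t₁ 0, mul_lt_mul_of_pos_left (max_lt ht₁ hT) hν, _, ENNReal.ofReal_ne_top,
    cknAEssSlab_of_weakL3 hν hmax.1 hM (le_max_right _ _) fun t ht => ?_⟩
  exact hweak t ⟨(le_max_left _ _).trans_lt ht.1, ht.2⟩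

end Summit.NavierStokesRegularity.NavierStokesRegularity.Theorems.TypeIliouvilleNoTypeII.WeakL3Reach

end
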